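import Mathlib
import HarnessLib

/-!
# The planted `INVALID-3` estimator shows on every record: `kl = ⟨W⟩ − dF_J ≥ 0`, `= 0` iff ties

HONEST FRAMING: exact (Metropolis-corrected) sampling algorithms for lattice gauge theory;
figures of merit are autocorrelation/cost numbers at stated couplings and volumes; no
continuum-physics claim.

Venture `LatticeQCDFlow` (cell pub-lqcd), topic `Exactness`; FANOUT row 13 (`eng-snf`, GEN-25).
NEW WORK of the cell (finite Jensen / AM–GM), Mathlib only; not a published result; no
definition; nothing cited as a fact.  The POPULATION statements (`⟨W⟩_F − ΔF = ⟨W_d⟩ ≥ 0`, `= 0`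
iff the protocol is dissipation-free) are GEN-10/11's `NCMCGeneralSpaceDissipation` /
`…DissipationFree` and, on a finite chain, `JarzynskiFinite.freeEnergy_le_work`; the weighted
finite Jensen for `log` is `FlowSamplerMixtureConvexity.sum_mul_log_le_log_sum`.  This file is the
SAMPLE-LEVEL statement about the two numbers the engine prints from ONE record of works.

WHY (row 13).  `estimators.free_energy(W)` prints the honest Jarzynski value
`dF_J = −log((1/n)Σ_i e^{−W_i})` (`method = 'jarzynski'`), the mean work `mean_W = (1/n)Σ_i W_i`,
and `kl = mean_W − dF_J`; the planted control `INVALID-3` (`controls.X-3`,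
`method = 'mean-work'`) CLAIMS `dF := mean_W` instead.  By Jensen for `exp` on the empirical
measure (uniform weights `1/n`):

  **`dF_J ≤ mean_W` on EVERY record** (`neg_log_avg_exp_neg_le_avg`) — the planted value never
  undershoots the honest one, the printed `kl` is `≥ 0` (`avg_add_log_avg_exp_neg_nonneg`);
  **strictly, `dF_J < mean_W`, unless all `W_i` coincide** (`neg_log_avg_exp_neg_lt_avg`, strict
  convexity), i.e. `kl = 0 ↔ W` is constant on the record (`avg_add_log_avg_exp_neg_eq_zero_iff`);
  and `min_i W_i ≤ dF_J` (`inf_le_neg_log_avg_exp_neg`), so `0 ≤ kl ≤ mean_W − min_i W_i`.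

So an `X-3` record is told apart from an honest one by recomputation alone — the claimed `dF`
exceeds `−log mean e^{−W}` of the same works by exactly the printed `kl > 0` — on every
non-degenerate record, before any comparison with an exact reference `ΔF` (which is what the
release test does, using the population bias `+⟨W_d⟩`).

NOT CLAIMED: anything about the population (see the files named above); anything numerical.
-/

namespace Summit.Ventures.LatticeQCDFlow.Exactness.GeneralNCMC

open Finset

section MeanWorkTruncation

variable {ι : Type*} [Fintype ι] [Nonempty ι]

/-- **`dF_J ≤ mean_W` on every record**: `−log((1/n)Σ_i e^{−W_i}) ≤ (1/n)Σ_i W_i`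
(Jensen for `exp` on the empirical measure). -/
theorem neg_log_avg_exp_neg_le_avg (W : ι → ℝ) :
    -Real.log ((∑ i, Real.exp (-W i)) / Fintype.card ι) ≤ (∑ i, W i) / Fintype.card ι := by
  have hn : (0 : ℝ) < Fintype.card ι := by exact_mod_cast Fintype.card_pos
  have hj := convexOn_exp.map_sum_le (t := univ) (w := fun _ : ι => (Fintype.card ι : ℝ)⁻¹)
    (p := fun i => -W i) (fun _ _ => by positivity)
    (by rw [sum_const, card_univ, nsmul_eq_mul, mul_inv_cancel₀ hn.ne']) (fun _ _ => Set.mem_univ _)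
  simp only [smul_eq_mul] at hj
  rw [← mul_sum, ← mul_sum] at hj
  -- `exp(−mean W) ≤ mean e^{−W}`; take logarithms
  have hpos : 0 < (Fintype.card ι : ℝ)⁻¹ * ∑ i, Real.exp (-W i) :=
    mul_pos (inv_pos.2 hn) (sum_pos (fun i _ => Real.exp_pos _) univ_nonempty)
  have hlog := Real.log_le_log (Real.exp_pos _) hj
  rw [Real.log_exp] at hlog
  rw [div_eq_inv_mul, div_eq_inv_mul]
  have : (Fintype.card ι : ℝ)⁻¹ * ∑ i, -W i = -((Fintype.card ι : ℝ)⁻¹ * ∑ i, W i) := by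
    rw [sum_neg_distrib, mul_neg]
  linarith [this]

/-- **The printed `kl = mean_W − dF_J` is nonnegative on every record.** -/
theorem avg_add_log_avg_exp_neg_nonneg (W : ι → ℝ) :
    0 ≤ (∑ i, W i) / Fintype.card ι - -Real.log ((∑ i, Real.exp (-W i)) / Fintype.card ι) :=
  sub_nonneg.2 (neg_log_avg_exp_neg_le_avg W)

/-- **Strictly `dF_J < mean_W` unless all works coincide** (strict convexity of `exp`). -/
theorem neg_log_avg_exp_neg_lt_avg (W : ι → ℝ) (h : ∃ i j, W i ≠ W j) :
    -Real.log ((∑ i, Real.exp (-W i)) / Fintype.card ι) < (∑ i, W i) / Fintype.card ι := by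
  have hn : (0 : ℝ) < Fintype.card ι := by exact_mod_cast Fintype.card_pos
  obtain ⟨i, j, hij⟩ := h
  have hj := strictConvexOn_exp.map_sum_lt (t := univ) (w := fun _ : ι => (Fintype.card ι : ℝ)⁻¹)
    (p := fun i => -W i) (fun _ _ => by positivity)
    (by rw [sum_const, card_univ, nsmul_eq_mul, mul_inv_cancel₀ hn.ne']) (fun _ _ => Set.mem_univ _)
    ⟨i, mem_univ _, j, mem_univ _, fun hh => hij (neg_injective hh)⟩
  simp only [smul_eq_mul] at hj
  rw [← mul_sum, ← mul_sum] at hj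
  have hlog := Real.log_lt_log (Real.exp_pos _) hj
  rw [Real.log_exp] at hlog
  rw [div_eq_inv_mul, div_eq_inv_mul]
  have : (Fintype.card ι : ℝ)⁻¹ * ∑ i, -W i = -((Fintype.card ι : ℝ)⁻¹ * ∑ i, W i) := by
    rw [sum_neg_distrib, mul_neg]
  linarith [this]

/-- **`kl = 0 ↔` the works are constant on the record.** -/
theorem avg_add_log_avg_exp_neg_eq_zero_iff (W : ι → ℝ) :
    (∑ i, W i) / Fintype.card ι - -Real.log ((∑ i, Real.exp (-W i)) / Fintype.card ι) = 0
      ↔ ∀ i j, W i = W j := by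
  constructor
  · intro h0
    by_contra hne
    push Not at hne
    obtain ⟨i, j, hij⟩ := hne
    have hlt := neg_log_avg_exp_neg_lt_avg W ⟨i, j, hij⟩
    linarith
  · intro hconst
    have hn : (Fintype.card ι : ℝ) ≠ 0 := by positivity
    obtain ⟨i₀⟩ := (inferInstance : Nonempty ι)
    have hW : ∀ i, W i = W i₀ := fun i => hconst i i₀
    simp_rw [hW]
    rw [sum_const, sum_const, card_univ, nsmul_eq_mul, nsmul_eq_mul, mul_div_cancel_left₀ _ hn,
      mul_div_cancel_left₀ _ hn, Real.log_exp]
    ring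

/-- **`min_i W_i ≤ dF_J`**: the Jarzynski value is at least the smallest work on the record
(so `0 ≤ kl ≤ mean_W − min_i W_i`). -/
theorem inf_le_neg_log_avg_exp_neg (W : ι → ℝ) :
    univ.inf' univ_nonempty W ≤ -Real.log ((∑ i, Real.exp (-W i)) / Fintype.card ι) := by
  have hn : (0 : ℝ) < Fintype.card ι := by exact_mod_cast Fintype.card_pos
  set m := univ.inf' univ_nonempty W with hm
  -- each `e^{−W_i} ≤ e^{−m}`, so the average is `≤ e^{−m}`
  have hle : (∑ i, Real.exp (-W i)) / Fintype.card ι ≤ Real.exp (-m) := by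
    rw [div_le_iff₀ hn]
    calc ∑ i, Real.exp (-W i) ≤ ∑ _i : ι, Real.exp (-m) :=
          sum_le_sum fun i _ => Real.exp_le_exp.2 (neg_le_neg (inf'_le _ (mem_univ i)))
      _ = Real.exp (-m) * Fintype.card ι := by
          rw [sum_const, card_univ, nsmul_eq_mul, mul_comm]
  have hpos : 0 < (∑ i, Real.exp (-W i)) / Fintype.card ι :=
    div_pos (sum_pos (fun i _ => Real.exp_pos _) univ_nonempty) hn
  have hlog := Real.log_le_log hpos hle
  rw [Real.log_exp] at hlog
  linarith

end MeanWorkTruncation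

end Summit.Ventures.LatticeQCDFlow.Exactness.GeneralNCMC
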